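import Literature.Analysis.FluidPDE.SphereRayOscillation
import Literature.Analysis.FluidPDE.DyadicChaining
import HarnessLib

/-!
# Dyadic chaining on radial shells: the three-dimensional statement

Analysis/FluidPDE support file for the discharge of the named fact
`Literature.Analysis.FluidPDE.tao2011_nonlinearEstimate` (the nonlinear term `Y₆` of Tao 2011,
Thm. 10.1, arXiv:1108.1165 p. 33, the control of `Σᵢ rᵢ⁴wᵢ³` by the parent-ball chaining).
It instantiates the one-dimensional chaining estimate
`DyadicChaining.ChainHyp.sum_four_pow_mass_rpow_le` with the spherical data of a `C¹` vector
field `ζ` about a centre `x₀` (`sphereNormSq`, `sphereGradSq`, the ray oscillation inequality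
`sq_sqrt_sphereNormSq_sub_le` and the weighted polar coordinates of `SphereRayOscillation`):

* **inner layer** (`sum_four_pow_shellMass_rpow_le_inner`): for `0 < a`, `0 < ℓ`, with the
  weight `ℓ⁻¹(|x - x₀| - a)` (Tao's `η = k·dist` on the transition layer, `k = ℓ⁻¹`), the shell
  masses `Aₙ = ∫_{ℓ/2ⁿ⁺⁶ < |x-x₀|-a < ℓ/2ⁿ⁺²} |ζ|² ℓ⁻¹(|x-x₀|-a)` and dissipations
  `Dₙ = ∫_{ℓ/2ⁿ⁺⁷ < |x-x₀|-a < ℓ/2ⁿ⁺²} ‖Dζ‖² ℓ⁻¹(|x-x₀|-a)` satisfy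
  `Σ_{n≤N} 4ⁿ Aₙ^{3/2} ≤ C √Wtot (Wtot + ℓ² Σ_{n≤N} Dₙ)` whenever `Aₙ ≤ Wtot`, `C = 27000·2²⁰/7`;
* **outer layer** (`sum_four_pow_shellMass_rpow_le_outer`): the same about the outer sphere,
  with the weight `ℓ⁻¹(b - |x - x₀|)`, for `ℓ ≤ b`.

The dictionary is exact: by polar coordinates about `x₀` and the substitution `ρ = a + t`
(resp. `ρ = b - t`), `Aₙ = DyadicChaining.mass ℓ m q n` and `Dₙ = DyadicChaining.diss ℓ g q n`
with `m(t)² = S(ρ(t))`, `g(t)² = G(ρ(t))`, `q(t) = ρ(t)²`.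

## Mathlib / tree search

Tree (reused): `DyadicChaining.*` (`ChainHyp`, `mass`, `diss`, `sum_four_pow_mass_rpow_le`);
`sphereNormSq`, `sphereGradSq`, `sq_sqrt_sphereNormSq_sub_le`, `continuous_sphereNormSq`,
`continuous_sphereGradSq`, `setIntegral_shell_mul_radial_eq_integral_sphereIntegral`
(`SphereRayOscillation`, `TaoHeatFlux`). Mathlib: `intervalIntegral.integral_comp_add_left`,
`intervalIntegral.integral_comp_sub_left`, `integral_Icc_eq_integral_Ioo`.

## References

* T. Tao, arXiv:1108.1165 (`Tao2011`), §10, proof of Thm. 10.1 (p. 33).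
-/

noncomputable section

open MeasureTheory Set Filter Topology Function Metric Finset
open scoped ENNReal NNReal BigOperators

namespace Literature.Analysis.FluidPDE

open DyadicChaining

/-- Local notation for physical space `ℝ³ = EuclideanSpace ℝ (Fin 3)`. -/
local notation "ℝ³" => EuclideanSpace ℝ (Fin 3)

section Inner

variable {ζ : ℝ³ → ℝ³} {x₀ : ℝ³} {a ℓ : ℝ}

/-- **Polar coordinates for a weighted shell about the inner sphere, in the distance variable
`t = |x - x₀| - a`:** for `F` continuous, `φ` continuous, `0 ≤ a` and `0 ≤ t₁ ≤ t₂`,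
`∫_{t₁ < |x-x₀|-a < t₂} F(x) φ(|x-x₀|-a) dx = ∫_{(t₁,t₂)} (a+t)² φ(t) S_F(a+t) dt`. [folklore] -/
theorem setIntegral_innerShell_eq {F : ℝ³ → ℝ} (hF : Continuous F) {φ : ℝ → ℝ} (hφ : Continuous φ)
    (x₀ : ℝ³) (ha : 0 ≤ a) {t₁ t₂ : ℝ} (ht₁ : 0 ≤ t₁) (ht : t₁ ≤ t₂) :
    ∫ x in {x : ℝ³ | t₁ < ‖x - x₀‖ - a ∧ ‖x - x₀‖ - a < t₂}, F x * φ (‖x - x₀‖ - a) =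
      ∫ t in Ioo t₁ t₂, (a + t) ^ 2 * φ t * sphereIntegral volume (fun y => F (x₀ + y)) (a + t) := by
  have hset : {x : ℝ³ | t₁ < ‖x - x₀‖ - a ∧ ‖x - x₀‖ - a < t₂} =
      {x : ℝ³ | a + t₁ < ‖x - x₀‖ ∧ ‖x - x₀‖ < a + t₂} := by
    ext x; simp only [mem_setOf_eq]; constructor <;> intro h <;> constructor <;> linarith [h.1, h.2]
  rw [hset]
  have h1 := setIntegral_shell_mul_radial_eq_integral_sphereIntegral hF
    (φ := fun ρ => φ (ρ - a)) ((hφ.comp (continuous_id.sub continuous_const)).continuousOn) x₀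
    (by linarith : 0 ≤ a + t₁) (b := a + t₂)
  rw [h1]
  -- substitute `ρ = a + t`
  have h2 := intervalIntegral.integral_comp_add_left
    (fun ρ => ρ ^ 2 * φ (ρ - a) * sphereIntegral volume (fun y => F (x₀ + y)) ρ) a (a := t₁) (b := t₂)
  rw [intervalIntegral.integral_of_le ht, intervalIntegral.integral_of_le (by linarith),
    integral_Ioc_eq_integral_Ioo, integral_Ioc_eq_integral_Ioo] at h2
  rw [← h2]
  refine setIntegral_congr_fun measurableSet_Ioo fun t _ => ?_
  simp only [add_sub_cancel_left]

/-- **The inner-layer chaining estimate in three dimensions.** Let `ζ ∈ C¹(ℝ³; ℝ³)`, `x₀` a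
centre, `0 < a`, `0 < ℓ`, `N ∈ ℕ`, and suppose the weighted shell masses
`Aₙ = ∫_{ℓ/2ⁿ⁺⁶ < |x-x₀|-a < ℓ/2ⁿ⁺²} |ζ|² ℓ⁻¹(|x-x₀|-a)` satisfy `Aₙ ≤ Wtot` for `n ≤ N`. Then
`Σ_{n≤N} 4ⁿ Aₙ √Aₙ ≤ (27000·2²⁰/7) √Wtot (Wtot + ℓ² Σ_{n≤N} Dₙ)`,
`Dₙ = ∫_{ℓ/2ⁿ⁺⁷ < |x-x₀|-a < ℓ/2ⁿ⁺²} ‖Dζ‖² ℓ⁻¹(|x-x₀|-a)` — Tao's bound for `Σᵢ rᵢ⁴wᵢ³` (p. 33) in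
shell form. [cite: Tao2011, §10, proof of Thm. 10.1 (p. 33, the bound for Σᵢ rᵢ⁴wᵢ³)] -/
theorem sum_four_pow_shellMass_rpow_le_inner (hζ : ContDiff ℝ 1 ζ) (x₀ : ℝ³) (ha : 0 < a)
    (hℓ : 0 < ℓ) (N : ℕ) {Wtot : ℝ}
    (hW : ∀ n ≤ N, ∫ x in {x : ℝ³ | ℓ / 2 ^ (n + 6) < ‖x - x₀‖ - a ∧ ‖x - x₀‖ - a < ℓ / 2 ^ (n + 2)},
        ‖ζ x‖ ^ 2 * (ℓ⁻¹ * (‖x - x₀‖ - a)) ≤ Wtot) :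
    ∑ n ∈ range (N + 1), 4 ^ n *
        ((∫ x in {x : ℝ³ | ℓ / 2 ^ (n + 6) < ‖x - x₀‖ - a ∧ ‖x - x₀‖ - a < ℓ / 2 ^ (n + 2)},
            ‖ζ x‖ ^ 2 * (ℓ⁻¹ * (‖x - x₀‖ - a))) *
          Real.sqrt (∫ x in {x : ℝ³ | ℓ / 2 ^ (n + 6) < ‖x - x₀‖ - a ∧ ‖x - x₀‖ - a < ℓ / 2 ^ (n + 2)},
            ‖ζ x‖ ^ 2 * (ℓ⁻¹ * (‖x - x₀‖ - a)))) ≤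
      27000 * 2 ^ 20 / 7 * Real.sqrt Wtot *
        (Wtot + ℓ ^ 2 * ∑ n ∈ range (N + 1),
          ∫ x in {x : ℝ³ | ℓ / 2 ^ (n + 7) < ‖x - x₀‖ - a ∧ ‖x - x₀‖ - a < ℓ / 2 ^ (n + 2)},
            ‖fderiv ℝ ζ x‖ ^ 2 * (ℓ⁻¹ * (‖x - x₀‖ - a))) := by
  -- the one-dimensional data
  set m : ℝ → ℝ := fun t => Real.sqrt (sphereNormSq ζ x₀ (a + t)) with hm
  set g : ℝ → ℝ := fun t => Real.sqrt (sphereGradSq ζ x₀ (a + t)) with hg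
  set q : ℝ → ℝ := fun t => (a + t) ^ 2 with hq
  set Qlo : ℕ → ℝ := fun n => (a + ℓ / 2 ^ (n + 7)) ^ 2 with hQlo
  set Qhi : ℕ → ℝ := fun n => (a + ℓ / 2 ^ (n + 2)) ^ 2 with hQhi
  have hSc : Continuous (sphereNormSq ζ x₀) := continuous_sphereNormSq hζ.continuous x₀
  have hGc : Continuous (sphereGradSq ζ x₀) := continuous_sphereGradSq hζ x₀
  have haff : Continuous fun t : ℝ => a + t := continuous_id.const_add a
  have hmc : Continuous m := Real.continuous_sqrt.comp (hSc.comp haff)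
  have hg2 : (fun t => g t ^ 2) = fun t => sphereGradSq ζ x₀ (a + t) :=
    funext fun t => Real.sq_sqrt (sphereGradSq_nonneg _ _ _)
  have hm2 : ∀ t, m t ^ 2 = sphereNormSq ζ x₀ (a + t) := fun t => Real.sq_sqrt (sphereNormSq_nonneg _ _ _)
  -- the dictionary `mass n = Aₙ`, `diss n = Dₙ`
  have hmass : ∀ n, mass ℓ m q n =
      ∫ x in {x : ℝ³ | ℓ / 2 ^ (n + 6) < ‖x - x₀‖ - a ∧ ‖x - x₀‖ - a < ℓ / 2 ^ (n + 2)},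
        ‖ζ x‖ ^ 2 * (ℓ⁻¹ * (‖x - x₀‖ - a)) := by
    intro n
    have h := setIntegral_innerShell_eq (F := fun x => ‖ζ x‖ ^ 2) (hζ.continuous.norm.pow 2)
      (φ := fun t => ℓ⁻¹ * t) (continuous_const.mul continuous_id) x₀ ha.le
      (t₁ := ℓ / 2 ^ (n + 6)) (t₂ := ℓ / 2 ^ (n + 2)) (by positivity) (tlo_lt_thi hℓ n).le
    rw [h, mass, tlo, thi, integral_Icc_eq_integral_Ioo]
    refine setIntegral_congr_fun measurableSet_Ioo fun t _ => ?_
    simp only [hq, hm2, sphereNormSq_def]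
    ring
  have hdiss : ∀ n, diss ℓ g q n =
      ∫ x in {x : ℝ³ | ℓ / 2 ^ (n + 7) < ‖x - x₀‖ - a ∧ ‖x - x₀‖ - a < ℓ / 2 ^ (n + 2)},
        ‖fderiv ℝ ζ x‖ ^ 2 * (ℓ⁻¹ * (‖x - x₀‖ - a)) := by
    intro n
    have h := setIntegral_innerShell_eq (F := fun x => ‖fderiv ℝ ζ x‖ ^ 2)
      ((hζ.continuous_fderiv one_ne_zero).norm.pow 2)
      (φ := fun t => ℓ⁻¹ * t) (continuous_const.mul continuous_id) x₀ ha.le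
      (t₁ := ℓ / 2 ^ (n + 7)) (t₂ := ℓ / 2 ^ (n + 2)) (by positivity) (ulo_lt_thi hℓ n).le
    rw [h, diss, ulo, thi, integral_Icc_eq_integral_Ioo]
    refine setIntegral_congr_fun measurableSet_Ioo fun t _ => ?_
    simp only [hq]
    rw [show g t ^ 2 = sphereGradSq ζ x₀ (a + t) from congrFun hg2 t, sphereGradSq_def]
    ring
  -- the hypotheses of the chaining argument
  have hch : ChainHyp ℓ N m g q Qlo Qhi Wtot := by
    refine ⟨hℓ, fun t _ => Real.sqrt_nonneg _, hmc.continuousOn, ?_, ?_, ?_, ?_, ?_, ?_, ?_, ?_, ?_⟩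
    · exact ((haff.pow 2)).continuousOn
    · rw [hg2]; exact (hGc.comp haff).continuousOn.integrableOn_compact isCompact_Icc
    · intro n; simp only [hQlo]; positivity
    · intro n _ t ht
      have ht0 : 0 ≤ t := (ulo_pos hℓ n).le.trans ht.1
      simp only [hQlo, hQhi, hq]
      constructor
      · exact pow_le_pow_left₀ (by positivity) (by unfold ulo at ht; linarith [ht.1]) 2
      · exact pow_le_pow_left₀ (by positivity) (by unfold thi at ht; linarith [ht.2]) 2
    · intro n
      simp only [hQlo, hQhi]
      have h32 : a + ℓ / 2 ^ (n + 2) ≤ 32 * (a + ℓ / 2 ^ (n + 7)) := by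
        have e : ℓ / 2 ^ (n + 2) = 32 * (ℓ / 2 ^ (n + 7)) := by
          rw [show (2:ℝ) ^ (n + 7) = 2 ^ (n + 2) * 32 by ring]
          field_simp
        rw [e]; nlinarith
      calc (a + ℓ / 2 ^ (n + 2)) ^ 2 ≤ (32 * (a + ℓ / 2 ^ (n + 7))) ^ 2 :=
            pow_le_pow_left₀ (by positivity) h32 2
        _ = 1024 * (a + ℓ / 2 ^ (n + 7)) ^ 2 := by ring
    · intro n
      simp only [hQlo]
      have h2 : a + ℓ / 2 ^ (n + 7) ≤ 2 * (a + ℓ / 2 ^ (n + 1 + 7)) := by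
        have e : ℓ / 2 ^ (n + 7) = 2 * (ℓ / 2 ^ (n + 1 + 7)) := by
          rw [show (2:ℝ) ^ (n + 1 + 7) = 2 ^ (n + 7) * 2 by ring]
          field_simp
        rw [e]; nlinarith
      calc (a + ℓ / 2 ^ (n + 7)) ^ 2 ≤ (2 * (a + ℓ / 2 ^ (n + 1 + 7))) ^ 2 :=
            pow_le_pow_left₀ (by positivity) h2 2
        _ = 4 * (a + ℓ / 2 ^ (n + 1 + 7)) ^ 2 := by ring
    · intro i n hin
      simp only [hQhi]
      have hle : ℓ / 2 ^ (n + 2) ≤ ℓ / 2 ^ (i + 2) := div_two_pow_anti hℓ.le (by omega)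
      have h1 : (a + ℓ / 2 ^ (n + 2)) ^ 2 ≤ (a + ℓ / 2 ^ (i + 2)) ^ 2 :=
        pow_le_pow_left₀ (by positivity) (by linarith) 2
      nlinarith [sq_nonneg (a + ℓ / 2 ^ (i + 2))]
    · intro s _ s' _ hss'
      simp only [hm, hg2]
      have h := sq_sqrt_sphereNormSq_sub_le hζ x₀ a 1 (by norm_num) hss'
      simp only [one_mul] at h
      exact h
    · intro n hn
      rw [hmass n]
      exact hW n hn
  have hmain := hch.sum_four_pow_mass_rpow_le
  simp only [hmass, hdiss] at hmain
  exact hmain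

end Inner

section Outer

variable {ζ : ℝ³ → ℝ³} {x₀ : ℝ³} {b ℓ : ℝ}

/-- **Polar coordinates for a weighted shell about the outer sphere, in the distance variable
`t = b - |x - x₀|`:** for `F`, `φ` continuous and `0 ≤ t₁ ≤ t₂ ≤ b`,
`∫_{t₁ < b-|x-x₀| < t₂} F(x) φ(b-|x-x₀|) dx = ∫_{(t₁,t₂)} (b-t)² φ(t) S_F(b-t) dt`. [folklore] -/
theorem setIntegral_outerShell_eq {F : ℝ³ → ℝ} (hF : Continuous F) {φ : ℝ → ℝ} (hφ : Continuous φ)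
    (x₀ : ℝ³) {t₁ t₂ : ℝ} (ht : t₁ ≤ t₂) (ht₂ : t₂ ≤ b) :
    ∫ x in {x : ℝ³ | t₁ < b - ‖x - x₀‖ ∧ b - ‖x - x₀‖ < t₂}, F x * φ (b - ‖x - x₀‖) =
      ∫ t in Ioo t₁ t₂, (b - t) ^ 2 * φ t * sphereIntegral volume (fun y => F (x₀ + y)) (b - t) := by
  have hset : {x : ℝ³ | t₁ < b - ‖x - x₀‖ ∧ b - ‖x - x₀‖ < t₂} =
      {x : ℝ³ | b - t₂ < ‖x - x₀‖ ∧ ‖x - x₀‖ < b - t₁} := by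
    ext x; simp only [mem_setOf_eq]; constructor <;> intro h <;> constructor <;> linarith [h.1, h.2]
  rw [hset]
  have h1 := setIntegral_shell_mul_radial_eq_integral_sphereIntegral hF
    (φ := fun ρ => φ (b - ρ)) ((hφ.comp (continuous_const.sub continuous_id)).continuousOn) x₀
    (by linarith : 0 ≤ b - t₂) (b := b - t₁)
  rw [h1]
  -- substitute `ρ = b - t`
  have h2 := intervalIntegral.integral_comp_sub_left
    (fun ρ => ρ ^ 2 * φ (b - ρ) * sphereIntegral volume (fun y => F (x₀ + y)) ρ) b (a := t₁) (b := t₂)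
  rw [intervalIntegral.integral_of_le ht, intervalIntegral.integral_of_le (by linarith),
    integral_Ioc_eq_integral_Ioo, integral_Ioc_eq_integral_Ioo] at h2
  rw [← h2]
  refine setIntegral_congr_fun measurableSet_Ioo fun t _ => ?_
  simp only [sub_sub_cancel]

/-- **The outer-layer chaining estimate in three dimensions** (mirror image of
`sum_four_pow_shellMass_rpow_le_inner` about the outer sphere `|x - x₀| = b`, weight
`ℓ⁻¹(b - |x-x₀|)`, for `ℓ ≤ b`). [cite: Tao2011, §10, proof of Thm. 10.1 (p. 33, the bound for Σᵢ rᵢ⁴wᵢ³)] -/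
theorem sum_four_pow_shellMass_rpow_le_outer (hζ : ContDiff ℝ 1 ζ) (x₀ : ℝ³) (hℓ : 0 < ℓ)
    (hb : ℓ ≤ b) (N : ℕ) {Wtot : ℝ}
    (hW : ∀ n ≤ N, ∫ x in {x : ℝ³ | ℓ / 2 ^ (n + 6) < b - ‖x - x₀‖ ∧ b - ‖x - x₀‖ < ℓ / 2 ^ (n + 2)},
        ‖ζ x‖ ^ 2 * (ℓ⁻¹ * (b - ‖x - x₀‖)) ≤ Wtot) :
    ∑ n ∈ range (N + 1), 4 ^ n *
        ((∫ x in {x : ℝ³ | ℓ / 2 ^ (n + 6) < b - ‖x - x₀‖ ∧ b - ‖x - x₀‖ < ℓ / 2 ^ (n + 2)},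
            ‖ζ x‖ ^ 2 * (ℓ⁻¹ * (b - ‖x - x₀‖))) *
          Real.sqrt (∫ x in {x : ℝ³ | ℓ / 2 ^ (n + 6) < b - ‖x - x₀‖ ∧ b - ‖x - x₀‖ < ℓ / 2 ^ (n + 2)},
            ‖ζ x‖ ^ 2 * (ℓ⁻¹ * (b - ‖x - x₀‖)))) ≤
      27000 * 2 ^ 20 / 7 * Real.sqrt Wtot *
        (Wtot + ℓ ^ 2 * ∑ n ∈ range (N + 1),
          ∫ x in {x : ℝ³ | ℓ / 2 ^ (n + 7) < b - ‖x - x₀‖ ∧ b - ‖x - x₀‖ < ℓ / 2 ^ (n + 2)},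
            ‖fderiv ℝ ζ x‖ ^ 2 * (ℓ⁻¹ * (b - ‖x - x₀‖))) := by
  have hb0 : 0 < b := hℓ.trans_le hb
  -- the one-dimensional data
  set m : ℝ → ℝ := fun t => Real.sqrt (sphereNormSq ζ x₀ (b - t)) with hm
  set g : ℝ → ℝ := fun t => Real.sqrt (sphereGradSq ζ x₀ (b - t)) with hg
  set q : ℝ → ℝ := fun t => (b - t) ^ 2 with hq
  set Qlo : ℕ → ℝ := fun n => (b - ℓ / 2 ^ (n + 2)) ^ 2 with hQlo
  set Qhi : ℕ → ℝ := fun n => (b - ℓ / 2 ^ (n + 7)) ^ 2 with hQhi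
  have hSc : Continuous (sphereNormSq ζ x₀) := continuous_sphereNormSq hζ.continuous x₀
  have hGc : Continuous (sphereGradSq ζ x₀) := continuous_sphereGradSq hζ x₀
  have haff : Continuous fun t : ℝ => b - t := continuous_const.sub continuous_id
  have hmc : Continuous m := Real.continuous_sqrt.comp (hSc.comp haff)
  have hg2 : (fun t => g t ^ 2) = fun t => sphereGradSq ζ x₀ (b - t) :=
    funext fun t => Real.sq_sqrt (sphereGradSq_nonneg _ _ _)
  have hm2 : ∀ t, m t ^ 2 = sphereNormSq ζ x₀ (b - t) := fun t => Real.sq_sqrt (sphereNormSq_nonneg _ _ _)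
  -- `ℓ/2ᵏ⁺² ≤ ℓ/4 ≤ b/4`
  have hthi : ∀ n, ℓ / 2 ^ (n + 2) ≤ b / 4 := fun n =>
    calc ℓ / 2 ^ (n + 2) ≤ ℓ / 2 ^ 2 := div_two_pow_anti hℓ.le (by omega)
      _ ≤ b / 4 := by norm_num; linarith
  -- the dictionary
  have hmass : ∀ n, mass ℓ m q n =
      ∫ x in {x : ℝ³ | ℓ / 2 ^ (n + 6) < b - ‖x - x₀‖ ∧ b - ‖x - x₀‖ < ℓ / 2 ^ (n + 2)},
        ‖ζ x‖ ^ 2 * (ℓ⁻¹ * (b - ‖x - x₀‖)) := by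
    intro n
    have h := setIntegral_outerShell_eq (F := fun x => ‖ζ x‖ ^ 2) (hζ.continuous.norm.pow 2)
      (φ := fun t => ℓ⁻¹ * t) (continuous_const.mul continuous_id) x₀ (b := b)
      (t₁ := ℓ / 2 ^ (n + 6)) (t₂ := ℓ / 2 ^ (n + 2)) (tlo_lt_thi hℓ n).le (by linarith [hthi n])
    rw [h, mass, tlo, thi, integral_Icc_eq_integral_Ioo]
    refine setIntegral_congr_fun measurableSet_Ioo fun t _ => ?_
    simp only [hq, hm2, sphereNormSq_def]
    ring
  have hdiss : ∀ n, diss ℓ g q n =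
      ∫ x in {x : ℝ³ | ℓ / 2 ^ (n + 7) < b - ‖x - x₀‖ ∧ b - ‖x - x₀‖ < ℓ / 2 ^ (n + 2)},
        ‖fderiv ℝ ζ x‖ ^ 2 * (ℓ⁻¹ * (b - ‖x - x₀‖)) := by
    intro n
    have h := setIntegral_outerShell_eq (F := fun x => ‖fderiv ℝ ζ x‖ ^ 2)
      ((hζ.continuous_fderiv one_ne_zero).norm.pow 2)
      (φ := fun t => ℓ⁻¹ * t) (continuous_const.mul continuous_id) x₀ (b := b)
      (t₁ := ℓ / 2 ^ (n + 7)) (t₂ := ℓ / 2 ^ (n + 2)) (ulo_lt_thi hℓ n).le (by linarith [hthi n])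
    rw [h, diss, ulo, thi, integral_Icc_eq_integral_Ioo]
    refine setIntegral_congr_fun measurableSet_Ioo fun t _ => ?_
    simp only [hq]
    rw [show g t ^ 2 = sphereGradSq ζ x₀ (b - t) from congrFun hg2 t, sphereGradSq_def]
    ring
  -- the hypotheses of the chaining argument
  have hch : ChainHyp ℓ N m g q Qlo Qhi Wtot := by
    refine ⟨hℓ, fun t _ => Real.sqrt_nonneg _, hmc.continuousOn, ?_, ?_, ?_, ?_, ?_, ?_, ?_, ?_, ?_⟩
    · exact ((haff.pow 2)).continuousOn
    · rw [hg2]; exact (hGc.comp haff).continuousOn.integrableOn_compact isCompact_Icc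
    · intro n; simp only [hQlo]
      have : 0 < b - ℓ / 2 ^ (n + 2) := by linarith [hthi n]
      positivity
    · intro n _ t ht
      have h1 : ℓ / 2 ^ (n + 7) ≤ t := by unfold ulo at ht; exact ht.1
      have h2 : t ≤ ℓ / 2 ^ (n + 2) := by unfold thi at ht; exact ht.2
      have hbt : 0 ≤ b - t := by linarith [hthi n]
      simp only [hQlo, hQhi, hq]
      constructor
      · exact pow_le_pow_left₀ (by linarith [hthi n]) (by linarith) 2
      · exact pow_le_pow_left₀ hbt (by linarith) 2
    · intro n
      simp only [hQlo, hQhi]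
      have h0 : 0 ≤ b - ℓ / 2 ^ (n + 7) := by
        have : ℓ / 2 ^ (n + 7) ≤ ℓ / 2 ^ (n + 2) := div_two_pow_anti hℓ.le (by omega)
        linarith [hthi n]
      have h32 : b - ℓ / 2 ^ (n + 7) ≤ 32 * (b - ℓ / 2 ^ (n + 2)) := by
        have : 0 ≤ ℓ / 2 ^ (n + 7) := by positivity
        linarith [hthi n]
      calc (b - ℓ / 2 ^ (n + 7)) ^ 2 ≤ (32 * (b - ℓ / 2 ^ (n + 2))) ^ 2 := pow_le_pow_left₀ h0 h32 2
        _ = 1024 * (b - ℓ / 2 ^ (n + 2)) ^ 2 := by ring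
    · intro n
      simp only [hQlo]
      have hle : ℓ / 2 ^ (n + 1 + 2) ≤ ℓ / 2 ^ (n + 2) := div_two_pow_anti hℓ.le (by omega)
      have h0 : 0 ≤ b - ℓ / 2 ^ (n + 2) := by linarith [hthi n]
      have h1 : (b - ℓ / 2 ^ (n + 2)) ^ 2 ≤ (b - ℓ / 2 ^ (n + 1 + 2)) ^ 2 :=
        pow_le_pow_left₀ h0 (by linarith) 2
      nlinarith [sq_nonneg (b - ℓ / 2 ^ (n + 1 + 2))]
    · intro i n _
      simp only [hQhi]
      have hi0 : 0 ≤ ℓ / 2 ^ (i + 7) := by positivity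
      have hn0 : 0 ≤ ℓ / 2 ^ (n + 7) := by positivity
      have hi7 : ℓ / 2 ^ (i + 7) ≤ ℓ / 2 ^ 7 := div_two_pow_anti hℓ.le (by omega)
      have hℓb : ℓ / 2 ^ 7 ≤ b / 128 := by norm_num; linarith
      have h1 : (b - ℓ / 2 ^ (n + 7)) ^ 2 ≤ b ^ 2 := pow_le_pow_left₀ (by linarith [hthi n,
        (div_two_pow_anti hℓ.le (show n + 2 ≤ n + 7 by omega) : ℓ / 2 ^ (n + 7) ≤ ℓ / 2 ^ (n + 2))]) (by linarith) 2
      have h2 : (127 / 128 * b) ^ 2 ≤ (b - ℓ / 2 ^ (i + 7)) ^ 2 :=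
        pow_le_pow_left₀ (by positivity) (by linarith) 2
      nlinarith [h1, h2, sq_nonneg b]
    · intro s _ s' _ hss'
      simp only [hm, hg2]
      have h := sq_sqrt_sphereNormSq_sub_le hζ x₀ b (-1) (by norm_num) hss'
      simp only [neg_one_mul, ← sub_eq_add_neg] at h
      exact h
    · intro n hn
      rw [hmass n]
      exact hW n hn
  have hmain := hch.sum_four_pow_mass_rpow_le
  simp only [hmass, hdiss] at hmain
  exact hmain

end Outer

end Literature.Analysis.FluidPDE

end
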